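import Literature.AlgebraicGeometry.ModuliOfAbelianVarieties.Lan2013.Sec61ToroidalEmbeddings
import HarnessLib

/-!
# [Lan2013] §6.1.2 — Holds companion of ★ `Sec61ToroidalEmbeddings`: API of its REAL content (Def. 6.1.2.5 `σ^⊥`; the induced
# `Γ`-action on `H`-points of edition 5) PROVED

K.-W. Lan, *Arithmetic compactifications of PEL-type Shimura varieties* [Lan2013PELCompactifications], §6.1.2 (book pp. 375–376;
2010 rev. pp. 419–421).  The statement file ★ `Sec61ToroidalEmbeddings` is a 0-theorem carpet (cell hodgecm-mathlib, squad TS, row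
R10a; squad RULING TS-1: cheap closed statements about a carpet's REAL declarations go into ONE theorem-only companion).  Its facts
`Lan2013_6124 … Lan2013_6128_5`, `Lan2013_6126_induced` are RELATIONS over the posited datum `ToroidalAmbient` and have no closed
instance to discharge; what IS real and closed is proved here (typer TS-t18 (g2)):

* Def. 6.1.2.5 `orthogonal σ = σ^⊥ = {x ∈ X(H) : ⟨x, y⟩ = 0 ∀ y ∈ σ}`: membership (`mem_orthogonal_iff`); the deg-checks recorded in its
  docstring, `∅^⊥ = X(H)` and `{0}^⊥ = X(H)` (`orthogonal_empty`, `orthogonal_zero` — the open stratum `M_{{0}} = M` has `H_{{0}} = H`);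
  antitonicity `σ ⊆ σ' ⇒ σ'^⊥ ≤ σ^⊥` (`orthogonal_antitone` — the inclusion of character groups behind `H_σ ↠ H_{σ'}`); and the link
  with §6.1.1's `σ^∨` (★ `Sec71….dualCone`, 2010 rev. Def. 6.1.1.7): `σ^⊥ = σ^∨ ∩ (−σ^∨)`, the group of invertible elements of the
  semigroup `σ^∨` (`mem_orthogonal_iff_mem_dualCone`) — which is why `M_σ = Spec_{𝒪_Z}(⊕_{χ ∈ σ^⊥} 𝒪_{M,χ})` in Lem. 6.1.2.6 is the torus
  part of the toric chart `M(σ) = Spec_{𝒪_Z}(⊕_{χ ∈ σ^∨} 𝒪_{M,χ})`.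
* Edition 5's `GammaStructure.twistGrp` («`Γ` acting on `X(H)`, which induces an action on `H`», §6.1.1 lead-in, book p. 374): the
  induced action of `γ` on `H`-points, `(γ·h)(χ) = h(γ⁻¹χ)` through the diagonalisation `D`, is MULTIPLICATIVE (`twistGrp_mul`) — `γ`
  acts on `H(T)` by group homomorphisms, as an action «on `H`» (a group scheme) must; from ★ `DiagonalisationOver.iso_mul`.

Theorems only; no `def`, no fact, no `sorry`, no `instance`, no notation; net debt 0.  HC_CM is proved only modulo the 7 printed
citations (2 remaining: hLiu418 = stmt-HodgeConjecture-24832, h413 = stmt-HodgeConjecture-24833) until rung 0 closes; this file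
discharges none of them.
-/

namespace Literature.AlgebraicGeometry.ModuliOfAbelianVarieties.Lan2013.Sec61ToroidalEmbeddings

open _root_.CategoryTheory _root_.AlgebraicGeometry
open Literature.AlgebraicGeometry.ModuliOfAbelianVarieties.Lan2013.Sec71AutomorphicFormsFourierJacobi (DualR dualCone)

universe u

/-! ## Def. 6.1.2.5 `σ^⊥` -/

section OrthogonalAPI

variable {S : ModuleCat.{u} ℤ}

/-- Def. 6.1.2.5 unfolded: `x ∈ σ^⊥ ↔ ⟨x, y⟩ = 0` for all `y ∈ σ` (`⟨x, y⟩ = y x`).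
[cite: Lan2013PELCompactifications, Def. 6.1.2.5 (p. 375)] -/
theorem mem_orthogonal_iff (σ : Set (DualR S)) (x : S) : x ∈ orthogonal σ ↔ ∀ y ∈ σ, y x = 0 := by
  simp [orthogonal, Submodule.mem_iInf, LinearMap.mem_ker]

/-- `∅^⊥ = X(H)` (deg-check of Def. 6.1.2.5's docstring). [cite: Lan2013PELCompactifications, Def. 6.1.2.5 (p. 375)] -/
theorem orthogonal_empty : orthogonal (∅ : Set (DualR S)) = ⊤ := by
  simp [orthogonal]

/-- `{0}^⊥ = X(H)`: for the cone `{0}` (whose toroidal embedding is `M({0}) = M` itself) `H_{{0}} = H`.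
[cite: Lan2013PELCompactifications, Def. 6.1.2.5 (p. 375)] -/
theorem orthogonal_zero : orthogonal ({0} : Set (DualR S)) = ⊤ := by
  simp [orthogonal]

/-- `σ ⊆ σ' ⇒ σ'^⊥ ≤ σ^⊥` — the inclusion `X(H_{σ'}) ⊆ X(H_σ)` (so `H_σ ↠ H_{σ'}` for `σ` a face of `σ'`).
[cite: Lan2013PELCompactifications, Def. 6.1.2.5 (p. 375)] -/
theorem orthogonal_antitone : Antitone (orthogonal (S := S)) :=
  fun _ _ h => le_iInf₂ fun y hy => iInf₂_le y (h hy)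

/-- `σ^⊥ = σ^∨ ∩ (−σ^∨)`: the orthogonal of Def. 6.1.2.5 is the group of invertible elements of the semigroup `σ^∨` of §6.1.1 (★
`dualCone`, «`σ^∨ := {x ∈ X(H) : ⟨x, y⟩ ≥ 0, ∀ y ∈ σ}`», 2010 rev. Def. 6.1.1.7) — the reason `M_σ = Spec ⊕_{χ ∈ σ^⊥} 𝒪_{M,χ}` (Lem. 6.1.2.6)
is a torsor under the torus part of the chart `M(σ) = Spec ⊕_{χ ∈ σ^∨} 𝒪_{M,χ}`. [cite: Lan2013PELCompactifications, Def. 6.1.2.5 (p. 375)] -/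
theorem mem_orthogonal_iff_mem_dualCone (σ : Set (DualR S)) (x : S) :
    x ∈ orthogonal σ ↔ x ∈ dualCone σ ∧ -x ∈ dualCone σ := by
  simp only [mem_orthogonal_iff, dualCone, Set.mem_setOf_eq, map_neg, neg_nonneg, ← forall_and]
  exact forall₂_congr fun y _ => ⟨fun h => ⟨h.ge, h.le⟩, fun h => le_antisymm h.2 h.1⟩

end OrthogonalAPI

/-! ## Edition 5: the induced action of `Γ` on `H`-points is by group homomorphisms -/

section GammaAPI

open scoped MonObj

variable {S Z : Scheme.{u}} {f : Z ⟶ S} {X : Type} [AddCommGroup X] {G : Type*} [Group G]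
  {φ : G →* ((ModuleCat.of ℤ X) ≃ₗ[ℤ] (ModuleCat.of ℤ X))} {H : Over S} [GrpObj H] {M : Over Z}
  (𝔊 : GammaStructure f X G φ H M)

/-- **«… which induces an action on `H`»** (§6.1.1 lead-in): for every `γ ∈ G` (acting on `X(H)` as `φ γ`) and every `Z`-scheme `T`,
the induced map `H(T) → H(γ·T)`, `h ↦ γ·h = (χ ↦ h((φ γ)⁻¹χ))` (`GammaStructure.twistGrp`, through the diagonalisation `D`) is
MULTIPLICATIVE — `γ` acts by group homomorphisms on points (★ `DiagonalisationOver.iso_mul`: `D` is multiplicative, and pre-composition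
with `(φ γ)⁻¹` is additive on characters). [cite: Lan2013PELCompactifications, §6.1.1 (p. 374)] -/
theorem GammaStructure.twistGrp_mul (γ : G) {T : Over Z} (h h' : (Over.map f).obj T ⟶ H) :
    𝔊.twistGrp γ (h * h') = 𝔊.twistGrp γ h * 𝔊.twistGrp γ h' := by
  unfold GammaStructure.twistGrp
  apply (𝔊.D.iso (𝔊.twistObj γ T)).injective
  -- `D.iso` at the twisted object `γ·T` and at `T` take values in the same character group `Hom(X, Γ(T, 𝒪_T)^×)` (same underlying
  -- scheme); `erw` sees through that identification.
  erw [Equiv.apply_symm_apply, 𝔊.D.iso_mul (𝔊.twistObj γ T), Equiv.apply_symm_apply, Equiv.apply_symm_apply,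
    𝔊.D.iso_mul T, AddMonoidHom.add_comp]
  rfl

end GammaAPI

end Literature.AlgebraicGeometry.ModuliOfAbelianVarieties.Lan2013.Sec61ToroidalEmbeddings
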